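import Summits.NavierStokesRegularity.NavierStokesRegularity.Theorems.PalasekTowerBreakdownEpisodeBaseAgmonSplit

/-!
# Agmon's inequality on a three-dimensional space with an EXPLICIT constant, III: `√2/π`

Cell `ns-blowup`, seat `ns-palasek-19179-p2` (g6; `--supports stmt-NavierStokesRegularity-19179`; support for the
stub `stub_strain_door` of the line `Cruxes/EpisodeBase/Lines/straindoor.lean`, whose closeness/threshold numerals
need a numerical Agmon constant). Sequel of parts I (`…AgmonFourier`) and II (`…AgmonSplit`). LABEL: E–C analysis
(KERNEL: theorems only; no definition, no named fact, no `sorry`; register-free). WHAT THIS IS NOT: not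
Navier–Stokes evidence — a Sobolev inequality; no flow, run, design or blow-up is exhibited or asserted.

THIS FILE (III), `E` a real inner product space with `Module.finrank ℝ E = 3`, `b` its standard orthonormal basis:
* `norm_le_agmon_explicit_complex` — `f : E → ℂ` smooth, all derivatives in `L²`:
  `‖f(x)‖ ≤ (√2/π) √( √(∑ᵢ ∫‖∂ᵢf‖²) · √(∑ᵢⱼ ∫‖∂ᵢ∂ⱼf‖²) )`;
* `norm_le_agmon_explicit_real` — the same for a real smooth `L²` field `φ : E → ℝ` (`IsSmoothL2Field`), by
  complexification;
* **`norm_le_agmon_explicit`** — the same for a smooth `L²` field `v : E → F` with values in ANY real inner product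
  space `F`, with NO dimensional loss (test the scalar inequality on `⟪e, v⟫`, `e = v(x)/‖v(x)‖`):
  `‖v(x)‖ ≤ (√2/π) · (∑ᵢ ‖∂ᵢv‖₂²)^{1/4} · (∑ᵢⱼ ‖∂ᵢ∂ⱼv‖₂²)^{1/4}`, `√2/π < 0.4502`.
The tree's `IsSmoothL2Field.norm_le_agmon_laplacian` / `norm_apply_le_agmon` (`agmonConst`, no value) are thereby
given a numerical competitor (`∑ᵢⱼ ‖∂ᵢ∂ⱼv‖₂² = ‖Δv‖₂²` for smooth `L²` fields, two integrations by parts, is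
NOT re-proved here; users holding `‖Δv‖₂` convert with the tree's Hessian–Laplacian identity).

References: S. Agmon, *Lectures on Elliptic Boundary Value Problems*, 1965, §13; J. C. Robinson, J. L. Rodrigo,
W. Sadowski, CUP 2016, Thm. 1.20 [cite: RobinsonRodrigoSadowski2016, Thm. 1.20]; E. M. Stein, G. Weiss, Princeton
1971, Ch. I Thm. 1.8, 2.3 [cite: SteinWeiss1971, Ch. I Thm. 2.3].
-/

noncomputable section

set_option linter.dupNamespace false

open MeasureTheory Filter Function Set Metric
open Literature.Analysis.FunctionSpaces
open scoped ENNReal NNReal RealInnerProductSpace Topology FourierTransform ContDiff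

namespace Summit.NavierStokesRegularity.NavierStokesRegularity.Theorems.AgmonExplicit

variable {E : Type*} [NormedAddCommGroup E] [InnerProductSpace ℝ E] [FiniteDimensional ℝ E]
  [MeasurableSpace E] [BorelSpace E]

/-! ## §5 The explicit Agmon inequalities: complex scalars, real scalars, vector fields -/

section Final

/-- `∫ ‖g‖ₑ² = ofReal (∫ ‖g‖²)` for an `L²` function. [cite: SteinWeiss1971, Ch. I Thm. 2.3] -/
theorem lintegral_enorm_sq_eq_ofReal_integral {F : Type*} [NormedAddCommGroup F] {g : E → F}
    (hg : MemLp g 2 volume) : ∫⁻ y, ‖g y‖ₑ ^ 2 = ENNReal.ofReal (∫ y, ‖g y‖ ^ 2) := by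
  have hint : Integrable (fun y => ‖g y‖ ^ 2) := (memLp_two_iff_integrable_sq_norm hg.1).1 hg
  rw [ofReal_integral_eq_lintegral_ofReal hint (Eventually.of_forall fun y => sq_nonneg _)]
  refine lintegral_congr fun y => ?_
  rw [← ofReal_norm, ENNReal.ofReal_pow (norm_nonneg _)]

omit [FiniteDimensional ℝ E] [MeasurableSpace E] [BorelSpace E] in
/-- Post-composition with a continuous linear map commutes with directional derivatives.
[cite: SteinWeiss1971, Ch. I Thm. 1.8] -/
theorem fderiv_clm_comp_apply {F G : Type*} [NormedAddCommGroup F] [NormedSpace ℝ F]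
    [NormedAddCommGroup G] [NormedSpace ℝ G] (L : F →L[ℝ] G) {w : E → F} (hw : Differentiable ℝ w)
    (y u : E) : fderiv ℝ (fun z => L (w z)) y u = L (fderiv ℝ w y u) := by
  have hcomp : (fun z => L (w z)) = ⇑L ∘ w := rfl
  rw [hcomp, (L.hasFDerivAt.comp y (hw y).hasFDerivAt).fderiv]
  rfl

/-- **Agmon's inequality with the explicit constant `√2/π`, complex scalars.** For `f : E → ℂ` smooth with all
derivatives in `L²` on a three-dimensional real inner product space `E`, and every `x`,
`‖f(x)‖ ≤ (√2/π) · (∑ᵢ ‖∂ᵢf‖₂²)^{1/4} · (∑ᵢⱼ ‖∂ᵢ∂ⱼf‖₂²)^{1/4}` (written with square roots; partial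
derivatives along the standard orthonormal basis). [cite: SteinWeiss1971, Ch. I Thm. 2.3] -/
theorem norm_le_agmon_explicit_complex (h3 : Module.finrank ℝ E = 3) {f : E → ℂ} (hf : ContDiff ℝ ∞ f)
    (hn : ∀ n : ℕ, ∫⁻ x, ‖iteratedFDeriv ℝ n f x‖ₑ ^ 2 < ⊤) (x : E) :
    ‖f x‖ ≤ Real.sqrt 2 / Real.pi *
      Real.sqrt (Real.sqrt (∑ i, ∫ y, ‖fderiv ℝ f y (stdOrthonormalBasis ℝ E i)‖ ^ 2) *
        Real.sqrt (∑ i, ∑ j, ∫ y, ‖fderiv ℝ (fun z => fderiv ℝ f z (stdOrthonormalBasis ℝ E j)) y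
          (stdOrthonormalBasis ℝ E i)‖ ^ 2)) := by
  have hπ : 0 < Real.pi := Real.pi_pos
  -- the real Sobolev integrals
  obtain ⟨Gr, hGr⟩ : ∃ Gr : ℝ, Gr = ∑ i, ∫ y, ‖fderiv ℝ f y (stdOrthonormalBasis ℝ E i)‖ ^ 2 := ⟨_, rfl⟩
  obtain ⟨Hr, hHr⟩ : ∃ Hr : ℝ, Hr = ∑ i, ∑ j, ∫ y, ‖fderiv ℝ (fun z => fderiv ℝ f z
    (stdOrthonormalBasis ℝ E j)) y (stdOrthonormalBasis ℝ E i)‖ ^ 2 := ⟨_, rfl⟩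
  rw [← hGr, ← hHr]
  have hGr0 : 0 ≤ Gr := by
    rw [hGr]; exact Finset.sum_nonneg fun i _ => integral_nonneg fun y => sq_nonneg _
  have hHr0 : 0 ≤ Hr := by
    rw [hHr]
    exact Finset.sum_nonneg fun i _ => Finset.sum_nonneg fun j _ => integral_nonneg fun y => sq_nonneg _
  have h1 : ∀ j, ContDiff ℝ ∞ (fun y => fderiv ℝ f y (stdOrthonormalBasis ℝ E j)) ∧
      ∀ n : ℕ, ∫⁻ x, ‖iteratedFDeriv ℝ n (fun y => fderiv ℝ f y (stdOrthonormalBasis ℝ E j)) x‖ₑ ^ 2 < ⊤ :=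
    fun j => smooth_l2_fderiv_apply hf hn (stdOrthonormalBasis ℝ E j)
  have h2 : ∀ i j, ContDiff ℝ ∞ (fun y => fderiv ℝ (fun z => fderiv ℝ f z (stdOrthonormalBasis ℝ E j)) y (stdOrthonormalBasis ℝ E i)) ∧
      ∀ n : ℕ, ∫⁻ x, ‖iteratedFDeriv ℝ n (fun y => fderiv ℝ (fun z => fderiv ℝ f z (stdOrthonormalBasis ℝ E j)) y (stdOrthonormalBasis ℝ E i)) x‖ₑ ^ 2
        < ⊤ := fun i j => smooth_l2_fderiv_apply (h1 j).1 (h1 j).2 (stdOrthonormalBasis ℝ E i)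
  have hG : (∑ i, ∫⁻ y, ‖fderiv ℝ f y (stdOrthonormalBasis ℝ E i)‖ₑ ^ 2) = ENNReal.ofReal Gr := by
    rw [hGr, ENNReal.ofReal_sum_of_nonneg fun i _ => integral_nonneg fun y => sq_nonneg _]
    exact Finset.sum_congr rfl fun i _ =>
      lintegral_enorm_sq_eq_ofReal_integral (memLp_two_of_smooth (h1 i).1 ((h1 i).2 0))
  have hH : (∑ i, ∑ j, ∫⁻ y, ‖fderiv ℝ (fun z => fderiv ℝ f z (stdOrthonormalBasis ℝ E j)) y (stdOrthonormalBasis ℝ E i)‖ₑ ^ 2) =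
      ENNReal.ofReal Hr := by
    rw [hHr, ENNReal.ofReal_sum_of_nonneg fun i _ => Finset.sum_nonneg fun j _ =>
      integral_nonneg fun y => sq_nonneg _]
    refine Finset.sum_congr rfl fun i _ => ?_
    rw [ENNReal.ofReal_sum_of_nonneg fun j _ => integral_nonneg fun y => sq_nonneg _]
    exact Finset.sum_congr rfl fun j _ =>
      lintegral_enorm_sq_eq_ofReal_integral (memLp_two_of_smooth (h2 i j).1 ((h2 i j).2 0))
  refine le_agmon_const_of_forall_radius hGr0 hHr0 fun R hR => ?_
  have h := enorm_le_agmon_split h3 hf hn hR x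
  have eq1 : ENNReal.ofReal (R / Real.pi) ^ (1 / 2 : ℝ) = ENNReal.ofReal (Real.sqrt (R / Real.pi)) := by
    rw [Real.sqrt_eq_rpow, ENNReal.ofReal_rpow_of_nonneg (by positivity) (by norm_num)]
  have eq2 : ENNReal.ofReal Gr ^ (1 / 2 : ℝ) = ENNReal.ofReal (Real.sqrt Gr) := by
    rw [Real.sqrt_eq_rpow, ENNReal.ofReal_rpow_of_nonneg hGr0 (by norm_num)]
  have eq3 : ENNReal.ofReal (1 / (4 * Real.pi ^ 3 * R)) ^ (1 / 2 : ℝ) =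
      ENNReal.ofReal (Real.sqrt (1 / (4 * Real.pi ^ 3 * R))) := by
    rw [Real.sqrt_eq_rpow, ENNReal.ofReal_rpow_of_nonneg (by positivity) (by norm_num)]
  have eq4 : ENNReal.ofReal Hr ^ (1 / 2 : ℝ) = ENNReal.ofReal (Real.sqrt Hr) := by
    rw [Real.sqrt_eq_rpow, ENNReal.ofReal_rpow_of_nonneg hHr0 (by norm_num)]
  rw [hG, hH, eq1, eq2, eq3, eq4, ← ENNReal.ofReal_mul (Real.sqrt_nonneg _),
    ← ENNReal.ofReal_mul (Real.sqrt_nonneg _),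
    ← ENNReal.ofReal_add (mul_nonneg (Real.sqrt_nonneg _) (Real.sqrt_nonneg _))
      (mul_nonneg (Real.sqrt_nonneg _) (Real.sqrt_nonneg _)), ← ofReal_norm] at h
  exact (ENNReal.ofReal_le_ofReal_iff (add_nonneg (mul_nonneg (Real.sqrt_nonneg _) (Real.sqrt_nonneg _))
    (mul_nonneg (Real.sqrt_nonneg _) (Real.sqrt_nonneg _)))).1 h

/-- **Agmon's inequality with the explicit constant `√2/π`, real scalars**: for a real smooth `L²` field
`φ : E → ℝ` (`IsSmoothL2Field`) on a three-dimensional space,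
`|φ(x)| ≤ (√2/π) · (∑ᵢ ‖∂ᵢφ‖₂²)^{1/4} · (∑ᵢⱼ ‖∂ᵢ∂ⱼφ‖₂²)^{1/4}`. [cite: SteinWeiss1971, Ch. I Thm. 2.3] -/
theorem norm_le_agmon_explicit_real (h3 : Module.finrank ℝ E = 3) {φ : E → ℝ} (hφ : IsSmoothL2Field φ)
    (x : E) :
    ‖φ x‖ ≤ Real.sqrt 2 / Real.pi *
      Real.sqrt (Real.sqrt (∑ i, ∫ y, ‖fderiv ℝ φ y (stdOrthonormalBasis ℝ E i)‖ ^ 2) *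
        Real.sqrt (∑ i, ∑ j, ∫ y, ‖fderiv ℝ (fun z => fderiv ℝ φ z (stdOrthonormalBasis ℝ E j)) y
          (stdOrthonormalBasis ℝ E i)‖ ^ 2)) := by
  -- complexify
  have hF : IsSmoothL2Field (fun y => Complex.ofRealCLM (φ y)) := hφ.clm_comp Complex.ofRealCLM
  have h := norm_le_agmon_explicit_complex h3 hF.contDiff hF.sobolev x
  have hφd : Differentiable ℝ φ := hφ.contDiff.differentiable (by simp)
  -- first and second derivatives of the complexification
  have hd1 : ∀ (v : E) (y : E), fderiv ℝ (fun z => Complex.ofRealCLM (φ z)) y v =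
      Complex.ofRealCLM (fderiv ℝ φ y v) := fun v y => fderiv_clm_comp_apply Complex.ofRealCLM hφd y v
  have hd1' : ∀ v : E, (fun y => fderiv ℝ (fun z => Complex.ofRealCLM (φ z)) y v) =
      fun y => Complex.ofRealCLM (fderiv ℝ φ y v) := fun v => funext (hd1 v)
  have hψd : ∀ v : E, Differentiable ℝ (fun y => fderiv ℝ φ y v) := fun v =>
    (hφ.fderiv_apply v).contDiff.differentiable (by simp)
  have hd2 : ∀ (u v : E) (y : E), fderiv ℝ (fun z => fderiv ℝ (fun z' => Complex.ofRealCLM (φ z')) z v) y u =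
      Complex.ofRealCLM (fderiv ℝ (fun z => fderiv ℝ φ z v) y u) := by
    intro u v y; rw [hd1' v]; exact fderiv_clm_comp_apply Complex.ofRealCLM (hψd v) y u
  have e0 : ‖Complex.ofRealCLM (φ x)‖ = ‖φ x‖ := by simp
  have e1 : ∀ v : E, (∫ y, ‖fderiv ℝ (fun z => Complex.ofRealCLM (φ z)) y v‖ ^ 2) =
      ∫ y, ‖fderiv ℝ φ y v‖ ^ 2 := by
    intro v; simp_rw [hd1 v]; simp
  have e2 : ∀ u v : E, (∫ y, ‖fderiv ℝ (fun z => fderiv ℝ (fun z' => Complex.ofRealCLM (φ z')) z v) y u‖ ^ 2) =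
      ∫ y, ‖fderiv ℝ (fun z => fderiv ℝ φ z v) y u‖ ^ 2 := by
    intro u v; simp_rw [hd2 u v]; simp
  simp_rw [e0, e1, e2] at h
  exact h

/-- **Agmon's inequality with the explicit constant `√2/π`, vector fields**: for a smooth `L²` field `v : E → F`
(`F` a real inner product space) on a three-dimensional real inner product space `E`, and every `x`,
`‖v(x)‖ ≤ (√2/π) · (∑ᵢ ‖∂ᵢv‖₂²)^{1/4} · (∑ᵢⱼ ‖∂ᵢ∂ⱼv‖₂²)^{1/4}` — no loss over the scalar case (test against the unit
vector `v(x)/‖v(x)‖`). The tree's `agmonConst` (`FluidPDE/NSStrongSpeedBound`) is thereby given a numerical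
competitor: `√2/π < 0.4502`. [cite: SteinWeiss1971, Ch. I Thm. 2.3] -/
theorem norm_le_agmon_explicit (h3 : Module.finrank ℝ E = 3) {F : Type*} [NormedAddCommGroup F]
    [InnerProductSpace ℝ F] {v : E → F} (hv : IsSmoothL2Field v) (x : E) :
    ‖v x‖ ≤ Real.sqrt 2 / Real.pi *
      Real.sqrt (Real.sqrt (∑ i, ∫ y, ‖fderiv ℝ v y (stdOrthonormalBasis ℝ E i)‖ ^ 2) *
        Real.sqrt (∑ i, ∑ j, ∫ y, ‖fderiv ℝ (fun z => fderiv ℝ v z (stdOrthonormalBasis ℝ E j)) y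
          (stdOrthonormalBasis ℝ E i)‖ ^ 2)) := by
  by_cases hx : v x = 0
  · rw [hx, norm_zero]; positivity
  -- the unit vector along `v x` and the scalar field `φ = ⟪e, v⟫`
  set e : F := ‖v x‖⁻¹ • v x with he
  have hxn : 0 < ‖v x‖ := norm_pos_iff.2 hx
  have he1 : ‖e‖ = 1 := by
    rw [he, norm_smul, norm_inv, norm_norm, inv_mul_cancel₀ hxn.ne']
  have hφ : IsSmoothL2Field (fun y => (innerSL ℝ e) (v y)) := hv.clm_comp (innerSL ℝ e)
  have h := norm_le_agmon_explicit_real h3 hφ x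
  have hvd : Differentiable ℝ v := hv.contDiff.differentiable (by simp)
  have hφx : (innerSL ℝ e) (v x) = ‖v x‖ := by
    simp only [innerSL_apply_apply, he, real_inner_smul_left, real_inner_self_eq_norm_sq]
    field_simp
  -- first and second derivatives of `φ` are the `e`-components of those of `v`
  have hd1 : ∀ (w : E) (y : E), fderiv ℝ (fun z => (innerSL ℝ e) (v z)) y w =
      (innerSL ℝ e) (fderiv ℝ v y w) := fun w y => fderiv_clm_comp_apply (innerSL ℝ e) hvd y w
  have hd1' : ∀ w : E, (fun y => fderiv ℝ (fun z => (innerSL ℝ e) (v z)) y w) =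
      fun y => (innerSL ℝ e) (fderiv ℝ v y w) := fun w => funext (hd1 w)
  have hVd : ∀ w : E, Differentiable ℝ (fun y => fderiv ℝ v y w) := fun w =>
    (hv.fderiv_apply w).contDiff.differentiable (by simp)
  have hd2 : ∀ (u w : E) (y : E), fderiv ℝ (fun z => fderiv ℝ (fun z' => (innerSL ℝ e) (v z')) z w) y u =
      (innerSL ℝ e) (fderiv ℝ (fun z => fderiv ℝ v z w) y u) := by
    intro u w y; rw [hd1' w]; exact fderiv_clm_comp_apply (innerSL ℝ e) (hVd w) y u
  have hcomp : ∀ z : F, ‖(innerSL ℝ e) z‖ ≤ ‖z‖ := fun z => by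
    rw [innerSL_apply_apply]
    exact (abs_real_inner_le_norm e z).trans (by rw [he1, one_mul])
  have hint : ∀ {g : E → F}, IsSmoothL2Field g → Integrable (fun y => ‖g y‖ ^ 2) := fun hg =>
    (memLp_two_iff_integrable_sq_norm hg.memLp_two.1).1 hg.memLp_two
  have hint' : ∀ {g : E → ℝ}, IsSmoothL2Field g → Integrable (fun y => ‖g y‖ ^ 2) := fun hg =>
    (memLp_two_iff_integrable_sq_norm hg.memLp_two.1).1 hg.memLp_two
  -- comparison of the Sobolev integrals
  have hG : (∑ i, ∫ y, ‖fderiv ℝ (fun z => (innerSL ℝ e) (v z)) y (stdOrthonormalBasis ℝ E i)‖ ^ 2) ≤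
      ∑ i, ∫ y, ‖fderiv ℝ v y (stdOrthonormalBasis ℝ E i)‖ ^ 2 := by
    refine Finset.sum_le_sum fun i _ => ?_
    simp_rw [hd1 (stdOrthonormalBasis ℝ E i)]
    exact integral_mono (hint' ((hv.fderiv_apply _).clm_comp (innerSL ℝ e))) (hint (hv.fderiv_apply _))
      fun y => pow_le_pow_left₀ (norm_nonneg _) (hcomp _) 2
  have hH : (∑ i, ∑ j, ∫ y, ‖fderiv ℝ (fun z => fderiv ℝ (fun z' => (innerSL ℝ e) (v z')) z
      (stdOrthonormalBasis ℝ E j)) y (stdOrthonormalBasis ℝ E i)‖ ^ 2) ≤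
      ∑ i, ∑ j, ∫ y, ‖fderiv ℝ (fun z => fderiv ℝ v z (stdOrthonormalBasis ℝ E j)) y
        (stdOrthonormalBasis ℝ E i)‖ ^ 2 := by
    refine Finset.sum_le_sum fun i _ => Finset.sum_le_sum fun j _ => ?_
    simp_rw [hd2 (stdOrthonormalBasis ℝ E i) (stdOrthonormalBasis ℝ E j)]
    exact integral_mono (hint' (((hv.fderiv_apply _).fderiv_apply _).clm_comp (innerSL ℝ e)))
      (hint ((hv.fderiv_apply _).fderiv_apply _)) fun y => pow_le_pow_left₀ (norm_nonneg _) (hcomp _) 2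
  rw [hφx, Real.norm_of_nonneg hxn.le] at h
  refine h.trans ?_
  have hπ : 0 < Real.pi := Real.pi_pos
  gcongr

end Final

end Summit.NavierStokesRegularity.NavierStokesRegularity.Theorems.AgmonExplicit

end
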